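import Literature.Probability.Process.RootedHardCoreVague
import Mathlib.Topology.UniformSpace.HeineCantor

/-!
# Benjamini–Schramm limit of ground states, II: re-rooting and local sums on the configuration space

Route `PalmUnimodularRigidity`, item `stmt-AtomisticToContinuum-9230` (`BenjaminiSchrammLimit`),
helper file 2. On the compact metric space `K = RootedHardCoreConfig E δ` of rooted `δ`-hard-core
configurations (`Literature/Probability/Process/RootedHardCoreConfig.lean`):

* `continuous_translate₂` — re-rooting `(S, y) ↦ S - y` is JOINTLY continuous on
  `LocalConfig E × E`;
* `isClosed_incidence` — the incidence set `𝕄 = {(S, y) | y ∈ S} ⊆ K × E` is closed;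
* the RE-ROOTING INVOLUTION `Θ (S, y) = (S - y, -y)` (for `y ∈ S`; junk `(S, -y)` otherwise) of the
  Campbell measure: `continuousOn_reroot` (continuous on `𝕄`), `measurable_reroot`;
* `continuous_integral_of_continuousOn` — LOCAL SUMS WITH CONFIGURATION-DEPENDENT SUMMANDS are
  continuous: for `Ψ : K × E → ℝ` continuous on `𝕄` and vanishing for `‖y‖ > R`,
  `S ↦ ∑_{y ∈ S} Ψ(S, y) = ∫ Ψ(S, ·) d(count|S)` is continuous on `K` (generalising
  `LocalConfig.continuous_integral_toMeasure`, the case `Ψ(S, y) = f(y)`): a fine two-way matching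
  is a bijection between the points of two nearby configurations in the window, and `Ψ` is uniformly
  continuous on the compact part of `𝕄` over the window. Both sides of the mass-transport identity
  tested against a bounded continuous local `Φ`, `S ↦ ∑_{y ∈ S} Φ(S, y)` and
  `S ↦ ∑_{y ∈ S} Φ(S - y, -y)`, are of this form.
-/

noncomputable section

open MeasureTheory Set Filter Metric TopologicalSpace
open scoped Topology ENNReal Classical

namespace Summit.AtomisticToContinuum.Crystallization.Theorems.BenjaminiSchrammLimit

open Literature.Probability.Process Literature.Probability.Process.LocalConfig

/-! ### Joint continuity of re-rooting -/

section Translate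

variable {E : Type*} [SeminormedAddCommGroup E]

/-- Translating one configuration by two vectors gives configurations matched at every radius with
tolerance the distance of the vectors. [folklore] -/
theorem locallyMatches_translate_translate (S : Set E) (y y' : E) (R : ℝ) :
    LocallyMatches R (dist y y') ((fun z => z - y) '' S) ((fun z => z - y') '' S) := by
  refine ⟨?_, ?_⟩
  · rintro _ ⟨z, hz, rfl⟩ _
    exact ⟨z - y, mem_image_of_mem _ hz, (dist_sub_left z y y').le⟩
  · rintro _ ⟨z, hz, rfl⟩ _
    exact ⟨z - y', mem_image_of_mem _ hz, (dist_sub_left z y y').le⟩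

/-- **Re-rooting is jointly continuous**: `(S, y) ↦ S - y` is continuous on `LocalConfig E × E`
(compose a fine matching of the configurations, translated, with the small translation
`S₀ - y₀ ∼ S₀ - y`). [folklore] -/
theorem continuous_translate₂ : Continuous fun p : LocalConfig E × E => p.1.translate p.2 := by
  refine continuous_iff_continuousAt.2 fun p₀ => ?_
  obtain ⟨S₀, y₀⟩ := p₀
  rw [ContinuousAt, tendsto_iff_locallyMatches]
  intro R ε hε
  have h1 : ∀ᶠ p : LocalConfig E × E in 𝓝 (S₀, y₀),
      LocallyMatches (R + ε + ‖y₀‖ + 1) (ε / 2) (S₀ : Set E) p.1 :=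
    (continuous_fst.tendsto (S₀, y₀)).eventually
      ((nhds_hasBasis_locallyMatches S₀).mem_of_mem (i := (R + ε + ‖y₀‖ + 1, ε / 2))
        (half_pos hε))
  have h2 : ∀ᶠ p : LocalConfig E × E in 𝓝 (S₀, y₀), dist p.2 y₀ < min (ε / 2) 1 :=
    (continuous_snd.tendsto (S₀, y₀)).eventually (ball_mem_nhds y₀ (lt_min (half_pos hε) one_pos))
  filter_upwards [h1, h2] with p hp1 hp2
  have hp2ε : dist y₀ p.2 ≤ ε / 2 := by
    rw [dist_comm]; exact (hp2.trans_le (min_le_left _ _)).le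
  have hnorm : ‖p.2‖ ≤ ‖y₀‖ + 1 := by
    have h := norm_le_norm_add_norm_sub' p.2 y₀
    have h' : ‖p.2 - y₀‖ < 1 := by
      rw [← dist_eq_norm]; exact hp2.trans_le (min_le_right _ _)
    linarith
  -- `S₀ - y₀ ∼ S₀ - p.2` (small translation) and `S₀ - p.2 ∼ p.1 - p.2` (translated matching)
  have hA : LocallyMatches (R + ε) (ε / 2) ((S₀.translate y₀ : LocalConfig E) : Set E)
      ((S₀.translate p.2 : LocalConfig E) : Set E) :=
    (locallyMatches_translate_translate (S₀ : Set E) y₀ p.2 (R + ε)).mono le_rfl hp2ε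
  have hB : LocallyMatches (R + ε + ‖y₀‖ + 1 - ‖p.2‖) (ε / 2)
      ((S₀.translate p.2 : LocalConfig E) : Set E) ((p.1.translate p.2 : LocalConfig E) : Set E) :=
    hp1.translate p.2
  have := hA.trans (R := R) hB (half_pos hε).le (half_pos hε).le (by linarith) (by linarith)
  rwa [add_halves] at this

end Translate

/-! ### The incidence set and the re-rooting involution -/

section Reroot

variable {E : Type*} [NormedAddCommGroup E] {δ : ℝ}

set_option quotPrecheck false in
/-- The incidence set `𝕄 = {(S, y) | y ∈ S}` of rooted hard-core configurations and their points. -/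
local notation "𝕄" => {p : RootedHardCoreConfig E δ × E | p.2 ∈ ((p.1.1 : LocalConfig E) : Set E)}

set_option quotPrecheck false in
/-- The re-rooting involution `Θ (S, y) = (S - y, -y)` of the Campbell measure (for `y ∈ S`; for
`y ∉ S` the junk value `(S, -y)`). -/
local notation "Θ" => fun p : RootedHardCoreConfig E δ × E =>
  ((if h : p.2 ∈ ((p.1.1 : LocalConfig E) : Set E) then p.1.reroot p.2 h else p.1 :
    RootedHardCoreConfig E δ), -p.2)

/-- **The incidence set is closed** (`δ > 0`): if `(Sₙ, yₙ) → (S, y)` with `yₙ ∈ Sₙ`, fine matchings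
put points of `S` arbitrarily close to `y`, and `S` is closed. [folklore] -/
theorem isClosed_incidence (hδ : 0 < δ) : IsClosed 𝕄 := by
  refine IsSeqClosed.isClosed fun u p hu hp => ?_
  obtain ⟨S, y⟩ := p
  have hS : Tendsto (fun n => (u n).1) atTop (𝓝 S) := (continuous_fst.tendsto _).comp hp
  have hy : Tendsto (fun n => (u n).2) atTop (𝓝 y) := (continuous_snd.tendsto _).comp hp
  have hS' : Tendsto (fun n => ((u n).1.1 : LocalConfig E)) atTop (𝓝 S.1) :=
    (continuous_subtype_val.tendsto _).comp hS
  change y ∈ ((S.1 : LocalConfig E) : Set E)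
  rw [← (RootedHardCoreConfig.isClosed_coe hδ S).closure_eq, Metric.mem_closure_iff]
  intro η hη
  have h1 := (tendsto_iff_locallyMatches.1 hS') (‖y‖ + 1) (η / 2) (half_pos hη)
  have h2 : ∀ᶠ n in atTop, dist (u n).2 y < min (η / 2) 1 :=
    (Metric.tendsto_nhds.1 hy) _ (lt_min (half_pos hη) one_pos)
  obtain ⟨n, hn1, hn2⟩ := (h1.and h2).exists
  have hnorm : ‖(u n).2‖ ≤ ‖y‖ + 1 := by
    have h := norm_le_norm_add_norm_sub' (u n).2 y
    have h' : ‖(u n).2 - y‖ < 1 := by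
      rw [← dist_eq_norm]; exact hn2.trans_le (min_le_right _ _)
    linarith
  obtain ⟨q, hq, hqd⟩ := hn1.1 (u n).2 (hu n) hnorm
  refine ⟨q, hq, ?_⟩
  calc dist y q ≤ dist y (u n).2 + dist (u n).2 q := dist_triangle _ _ _
    _ < η / 2 + η / 2 := add_lt_add_of_lt_of_le
        (by rw [dist_comm]; exact hn2.trans_le (min_le_left _ _)) (by rwa [dist_comm])
    _ = η := add_halves η

/-- **The re-rooting involution is continuous on the incidence set.** [folklore] -/
theorem continuousOn_reroot : ContinuousOn Θ 𝕄 := by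
  rw [continuousOn_iff_continuous_restrict]
  have heq : (𝕄).restrict Θ = fun m : 𝕄 =>
      ((m.1.1.reroot m.1.2 m.2 : RootedHardCoreConfig E δ), -m.1.2) := by
    funext m
    have hm : m.1.2 ∈ ((m.1.1.1 : LocalConfig E) : Set E) := m.2
    simp only [restrict_apply, dif_pos hm]
  rw [heq]
  refine Continuous.prodMk ?_ (continuous_neg.comp (continuous_snd.comp continuous_subtype_val))
  refine Continuous.subtype_mk ?_ _
  exact continuous_translate₂.comp ((continuous_subtype_val.comp continuous_fst).prodMk
    continuous_snd |>.comp continuous_subtype_val)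

variable [MeasurableSpace E] [BorelSpace E]

/-- **The re-rooting involution is Borel measurable** (`δ > 0`): continuous on the closed incidence
set and equal to `(S, y) ↦ (S, -y)` off it. [folklore] -/
theorem measurable_reroot (hδ : 0 < δ) [SecondCountableTopology E] : Measurable Θ := by
  refine Measurable.prodMk ?_ measurable_snd.neg
  refine Measurable.dite (f := fun m : 𝕄 => (m.1.1.reroot m.1.2 m.2 : RootedHardCoreConfig E δ))
    ?_ (measurable_fst.comp measurable_subtype_coe) (isClosed_incidence hδ).measurableSet
  refine Continuous.measurable ?_
  refine Continuous.subtype_mk ?_ _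
  exact continuous_translate₂.comp ((continuous_subtype_val.comp continuous_fst).prodMk
    continuous_snd |>.comp continuous_subtype_val)

end Reroot

/-! ### Local sums with configuration-dependent summands -/

section LocalSums

variable {E : Type*} [NormedAddCommGroup E] [ProperSpace E] [MeasurableSpace E] [BorelSpace E]
  {δ : ℝ}

set_option quotPrecheck false in
/-- The incidence set `𝕄 = {(S, y) | y ∈ S}` of rooted hard-core configurations and their points. -/
local notation "𝕄" => {p : RootedHardCoreConfig E δ × E | p.2 ∈ ((p.1.1 : LocalConfig E) : Set E)}

/-- **Local sums with configuration-dependent summands are continuous.** For `δ > 0`, `E` proper,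
and `Ψ : RootedHardCoreConfig E δ × E → ℝ` continuous on the incidence set `𝕄` and vanishing for
`‖y‖ > R`, the local sum `S ↦ ∑_{y ∈ S} Ψ(S, y) = ∫ Ψ(S, ·) d(count|S)` is continuous: a fine
two-way matching of `S` with `S₀` is, by separation, a bijection `p ↦ q(p)` between their points in
the window, and `|Ψ(S, p) - Ψ(S₀, q(p))|` is small by uniform continuity of `Ψ` on the compact part
of `𝕄` over the window. (The case `Ψ(S, y) = f(y)` is `LocalConfig.continuous_integral_toMeasure`.)
[folklore] -/
theorem continuous_integral_of_continuousOn (hδ : 0 < δ) {Ψ : RootedHardCoreConfig E δ × E → ℝ}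
    (hΨ : ContinuousOn Ψ 𝕄) {R : ℝ}
    (hR : ∀ p : RootedHardCoreConfig E δ × E, R < ‖p.2‖ → Ψ p = 0) :
    Continuous fun S : RootedHardCoreConfig E δ =>
      ∫ y, Ψ (S, y) ∂((S.1 : LocalConfig E).toMeasure) := by
  classical
  haveI : Fact (0 < δ) := ⟨hδ⟩
  refine continuous_iff_continuousAt.2 fun S₀ => ?_
  rw [ContinuousAt, Metric.tendsto_nhds]
  intro η hη
  -- the windows: `W'` (domain of the matching) and `W₁`
  set W' : Set E := closedBall (0 : E) (R + 1 / 2) with hW'_def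
  set W₁ : Set E := closedBall (0 : E) (R + 1) with hW₁_def
  have hW' : IsCompact W' := isCompact_closedBall _ _
  have hW₁ : IsCompact W₁ := isCompact_closedBall _ _
  have hΨW' : ∀ S : RootedHardCoreConfig E δ, ∀ x, x ∉ W' → Ψ (S, x) = 0 := fun S x hx =>
    hR (S, x) (by rw [hW'_def, mem_closedBall_zero_iff, not_le] at hx; linarith)
  have hΨW₁ : ∀ S : RootedHardCoreConfig E δ, ∀ x, x ∉ W₁ → Ψ (S, x) = 0 := fun S x hx =>
    hR (S, x) (by rw [hW₁_def, mem_closedBall_zero_iff, not_le] at hx; linarith)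
  -- the finitely many points of `S₀` in `W₁`
  have hF₀ : (W₁ ∩ ((S₀.1 : LocalConfig E) : Set E)).Finite := finite_inter_of_separated hδ S₀.2.2 hW₁
  set n : ℕ := hF₀.toFinset.card with hn_def
  -- uniform continuity of `Ψ` on the compact part of `𝕄` over `W₁`
  have hC : IsCompact (𝕄 ∩ univ ×ˢ W₁) :=
    (isCompact_univ.prod hW₁).of_isClosed_subset
      ((isClosed_incidence hδ).inter (isClosed_univ.prod isClosed_closedBall)) inter_subset_right
  obtain ⟨θ, hθ, hθΨ⟩ := Metric.uniformContinuousOn_iff.1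
    (hC.uniformContinuousOn_of_continuous (hΨ.mono inter_subset_left)) (η / (n + 1)) (by positivity)
  -- tolerance of the matching
  set ε : ℝ := min (θ / 2) (min (δ / 3) (1 / 2)) with hε_def
  have hε : 0 < ε := lt_min (by positivity) (lt_min (by positivity) (by norm_num))
  have hεθ : ε < θ := by
    have := min_le_left (θ / 2) (min (δ / 3) (1 / 2))
    linarith
  have h2ε : 2 * ε < δ := by
    have := (min_le_right (θ / 2) (min (δ / 3) (1 / 2))).trans (min_le_left _ _)
    linarith
  have hε2 : ε ≤ 1 / 2 := (min_le_right _ _).trans (min_le_right _ _)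
  have hW'R : ∀ x ∈ W', ‖x‖ ≤ R + 1 := fun x hx => by
    rw [hW'_def, mem_closedBall_zero_iff] at hx; linarith
  have hW₁R : ∀ x ∈ W₁, ‖x‖ ≤ R + 1 := fun x hx => by rwa [hW₁_def, mem_closedBall_zero_iff] at hx
  -- eventually, a two-way `(R + 1, ε)`-matching and metric closeness
  have hev : ∀ᶠ S : RootedHardCoreConfig E δ in 𝓝 S₀,
      LocallyMatches (R + 1) ε ((S₀.1 : LocalConfig E) : Set E) ((S.1 : LocalConfig E) : Set E) :=
    (continuous_subtype_val.tendsto S₀).eventually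
      ((nhds_hasBasis_locallyMatches S₀.1).mem_of_mem (i := (R + 1, ε)) hε)
  have hev' : ∀ᶠ S : RootedHardCoreConfig E δ in 𝓝 S₀, dist S S₀ < θ / 2 :=
    Metric.ball_mem_nhds S₀ (half_pos hθ)
  filter_upwards [hev, hev'] with S hS hSθ
  -- the points of `S` in `W'` and their matches in `S₀`
  have hD : (W' ∩ ((S.1 : LocalConfig E) : Set E)).Finite := finite_inter_of_separated hδ S.2.2 hW'
  have hq : ∀ p ∈ W' ∩ ((S.1 : LocalConfig E) : Set E),
      ∃ q ∈ ((S₀.1 : LocalConfig E) : Set E), dist q p ≤ ε := fun p hp =>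
    hS.1 p hp.2 (hW'R p hp.1)
  choose! q hq using hq
  have hqW₁ : ∀ p ∈ W' ∩ ((S.1 : LocalConfig E) : Set E), q p ∈ W₁ := fun p hp => by
    rw [hW₁_def, mem_closedBall_zero_iff]
    have h1 : ‖p‖ ≤ R + 1 / 2 := by
      have := hp.1; rwa [hW'_def, mem_closedBall_zero_iff] at this
    have h2 : ‖q p‖ ≤ ‖p‖ + dist (q p) p := by
      rw [dist_eq_norm]; linarith [norm_le_norm_add_norm_sub' (q p) p]
    linarith [(hq p hp).2]
  have hqF₀ : ∀ p ∈ hD.toFinset, q p ∈ hF₀.toFinset := fun p hp => by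
    rw [Finite.mem_toFinset] at hp ⊢
    exact ⟨hqW₁ p hp, (hq p hp).1⟩
  have hqinj : Set.InjOn q ↑hD.toFinset := by
    intro p hp p' hp' hpp'
    rw [Finset.mem_coe, Finite.mem_toFinset] at hp hp'
    by_contra hne
    have h1 := S.2.2 p hp.2 p' hp'.2 hne
    have : dist p p' ≤ 2 * ε :=
      calc dist p p' ≤ dist p (q p) + dist (q p) p' := dist_triangle _ _ _
        _ ≤ ε + ε := add_le_add (by rw [dist_comm]; exact (hq p hp).2)
            (by rw [hpp']; exact (hq p' hp').2)
        _ = 2 * ε := by ring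
    linarith
  -- every point of `S₀` where `Ψ (S₀, ·) ≠ 0` is matched
  have himage : ∀ q₀ ∈ hF₀.toFinset, q₀ ∉ hD.toFinset.image q → Ψ (S₀, q₀) = 0 := by
    intro q₀ hq₀ hq₀im
    by_contra hΨq₀
    rw [Finite.mem_toFinset] at hq₀
    have hq₀R : ‖q₀‖ ≤ R := by
      by_contra h
      exact hΨq₀ (hR (S₀, q₀) (not_le.1 h))
    obtain ⟨p', hp'S, hq₀p'⟩ := hS.2 q₀ hq₀.2 (by linarith)
    have hp'D : p' ∈ hD.toFinset := by
      rw [Finite.mem_toFinset]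
      refine ⟨?_, hp'S⟩
      rw [hW'_def, mem_closedBall_zero_iff]
      have h2 : ‖p'‖ ≤ ‖q₀‖ + dist q₀ p' := by
        rw [dist_eq_norm]; linarith [norm_le_norm_add_norm_sub' p' q₀, norm_sub_rev q₀ p']
      linarith
    have hp'D' : p' ∈ W' ∩ ((S.1 : LocalConfig E) : Set E) := by
      rwa [Finite.mem_toFinset] at hp'D
    have hqq₀ : q p' = q₀ := by
      by_contra hne
      have h1 := S₀.2.2 (q p') (hq p' hp'D').1 q₀ hq₀.2 hne
      have : dist (q p') q₀ ≤ 2 * ε :=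
        calc dist (q p') q₀ ≤ dist (q p') p' + dist p' q₀ := dist_triangle _ _ _
          _ ≤ ε + ε := add_le_add (hq p' hp'D').2 (by rw [dist_comm]; exact hq₀p')
          _ = 2 * ε := by ring
      linarith
    exact hq₀im (Finset.mem_image.2 ⟨p', hp'D, hqq₀⟩)
  -- the two integrals as finite sums
  rw [integral_toMeasure_eq_finset_sum S hW' (hΨW' S) hD,
    integral_toMeasure_eq_finset_sum S₀ hW₁ (hΨW₁ S₀) hF₀, Real.dist_eq]
  have hsum₀ : ∑ y ∈ hF₀.toFinset, Ψ (S₀, y) = ∑ p ∈ hD.toFinset, Ψ (S₀, q p) := by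
    rw [← Finset.sum_image (g := q) (f := fun y => Ψ (S₀, y)) hqinj,
      ← Finset.sum_sdiff (Finset.image_subset_iff.2 hqF₀),
      Finset.sum_eq_zero fun x hx => himage x (Finset.mem_sdiff.1 hx).1 (Finset.mem_sdiff.1 hx).2,
      zero_add]
  rw [hsum₀, ← Finset.sum_sub_distrib]
  -- termwise estimate (uniform continuity on `𝕄 ∩ univ ×ˢ W₁`) and counting
  have hcard : hD.toFinset.card ≤ n := Finset.card_le_card_of_injOn q hqF₀ hqinj
  have hterm : ∀ p ∈ hD.toFinset, |Ψ (S, p) - Ψ (S₀, q p)| ≤ η / (n + 1) := fun p hp => by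
    have hp' : p ∈ W' ∩ ((S.1 : LocalConfig E) : Set E) := by rwa [Finite.mem_toFinset] at hp
    have h1 : ((S, p) : RootedHardCoreConfig E δ × E) ∈ 𝕄 ∩ univ ×ˢ W₁ :=
      ⟨hp'.2, mem_univ _, closedBall_subset_closedBall (by norm_num) hp'.1⟩
    have h2 : ((S₀, q p) : RootedHardCoreConfig E δ × E) ∈ 𝕄 ∩ univ ×ˢ W₁ :=
      ⟨(hq p hp').1, mem_univ _, hqW₁ p hp'⟩
    have hd : dist ((S, p) : RootedHardCoreConfig E δ × E) (S₀, q p) < θ := by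
      rw [Prod.dist_eq]
      refine max_lt (hSθ.trans (half_lt_self hθ)) ?_
      rw [dist_comm]
      exact (hq p hp').2.trans_lt hεθ
    have := hθΨ _ h1 _ h2 hd
    rw [Real.dist_eq] at this
    exact this.le
  calc |∑ p ∈ hD.toFinset, (Ψ (S, p) - Ψ (S₀, q p))|
      ≤ ∑ p ∈ hD.toFinset, |Ψ (S, p) - Ψ (S₀, q p)| := Finset.abs_sum_le_sum_abs _ _
    _ ≤ ∑ _p ∈ hD.toFinset, η / (n + 1) := Finset.sum_le_sum hterm
    _ = hD.toFinset.card * (η / (n + 1)) := by rw [Finset.sum_const, nsmul_eq_mul]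
    _ ≤ n * (η / (n + 1)) := by gcongr
    _ < η := by
        rw [mul_div_assoc', div_lt_iff₀ (by positivity)]
        nlinarith

end LocalSums

end Summit.AtomisticToContinuum.Crystallization.Theorems.BenjaminiSchrammLimit
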